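import Literature.Analysis.FluidPDE.NSSereginMildStabilityTools
import Literature.Analysis.FluidPDE.LocalLerayDifferenceAssembly
import Literature.Analysis.FluidPDE.KatoLocalLerayPressureProofs
import Literature.Analysis.FluidPDE.KatoLocalHolds
import Literature.Analysis.FluidPDE.DistributionalToWeakCounterexample
import Literature.MeasureTheory.Lebesgue.SaturatedNonmeasurableSet
import HarnessLib

/-!
# The local energy estimate **U₁** fails for non-measurable data: a counterexample, and the
refutation of `local_leray_difference_energy_estimate`

Analysis/FluidPDE refutation file (theorems only, everything PROVED). The named fact
`Literature.Analysis.FluidPDE.local_leray_difference_energy_estimate` (**U₁**,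
`LocalLerayWeakStrongProofs.lean`; cited to P. G. Lemarié-Rieusset, *The Navier–Stokes Problem in
the 21st Century* (2016), proof of Thm. 14.7, held copy pp. 515–518) and the `L²_uloc`-datum form
of weak–strong uniqueness through which it implies **U** (the hypothesis of
`local_leray_weak_strong_uniqueness_of_uloc`, `LocalLerayWeakStrong.lean`) are quantified over an
ARBITRARY datum `u₀ : ℝ³ → ℝ³`, constrained only by a bound on the *lower* Lebesgue integrals
`∫⁻_{B(x₀,1)} ‖u₀‖ₑ²` and by `IsWeaklyDivFree u₀` (a *Bochner* integral, junk value `0`), while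
the class `IsLocalLeraySolutionOn T ν u₀ v π` ties `v` to `u₀` only through the *lower* integrals
`∫⁻_K ‖v t - u₀‖ₑ²` of its clause `initial`. The printed theorem has `u₀ ∈ L²_uloc`, a class of
*measurable* fields (Lemarié-Rieusset 2016, §14.1, p. 488). **Without measurability both
statements are false**, and this file proves it, sorry-free:

* `not_local_leray_weak_strong_uniqueness_uloc` — the `L²_uloc`-datum form of Thm. 14.7, written
  out in full (it is the hypothesis of `local_leray_weak_strong_uniqueness_of_uloc`), is false;
* `not_local_leray_difference_energy_estimate : ¬ local_leray_difference_energy_estimate` — since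
  the tree's Grönwall endgame derives that form from **U₁**
  (`uloc_uniqueness_of_difference_energy_estimate`, the body of
  `local_leray_weak_strong_uniqueness_of`).

**U** itself (`local_leray_weak_strong_uniqueness`, datum in `MemE2`, which contains
`AEStronglyMeasurable u₀ volume`) is not affected, and neither is
`local_leray_weak_strong_uniqueness_of : U₁ → U` (now vacuous). The corrected fact — **U₁** with
the single extra hypothesis `AEStronglyMeasurable u₀ volume` — is vendored separately
(`LocalLerayWeakStrongMeasurable.lean`), together with the endgame from it to **U**.

## The counterexample (namespace `LocalLerayNonmeasurableDatum`)

* `A ⊆ ℝ³` a **saturated non-measurable set**: every measurable subset of `A` *and* every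
  measurable subset of `Aᶜ` is null (Halmos 1950, §16 Thm. E;
  `Literature.MeasureTheory.Lebesgue.exists_saturated_euclideanSpace`).
* `θ` the smooth, compactly supported, divergence-free field `curl (η e₂) ≢ 0` of
  `DistributionalToWeakCounterexample`; `θ ∈ L³` and `θ` is weakly divergence free
  (`IsDivFree.isWeaklyDivFree_holds`).
* the datum `u₀ := 𝟙_A θ`. Its unit-ball lower integrals vanish (the integrand is supported in
  `A`: `lintegral_eq_zero_of_innerNull`), and it is weakly divergence free: `x ↦ ⟪u₀ x, ∇ϑ x⟫` is
  supported in `A`, hence a.e. zero if a.e.-strongly measurable and with Bochner integral `0`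
  otherwise (`integral_eq_zero_of_eq_zero_off_innerNull`).
* `u₁ := 0`, `p₁ := 0`: a local Leray solution with datum `u₀` — all clauses of the zero flow
  (`isLocalLeraySolutionOn_zero`) except `initial`, and `∫⁻_K ‖0 - u₀‖ₑ² = 0` for every `t`.
* `u₂ :=` the Kato (mild `L³`) solution with datum `θ` (`kato_local_holds`), a local Leray
  solution with datum `θ` on `(0, S)`, `S = T/2` (`kato_isLocalLeraySolutionOn_holds`,
  Lemarié-Rieusset 2016 Thm. 15.1 (A)), hence ALSO with datum `u₀`:
  `∫⁻_K ‖u₂ t - 𝟙_A θ‖ₑ² ≤ ∫⁻_K ‖u₂ t - θ‖ₑ² → 0`, because the two integrands agree off `Aᶜ`, a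
  set invisible to lower integrals (`lintegral_le_lintegral_of_innerNull`).
* `u₃ := u₄ := 0`, `m := 0`, `ε := 0 < ε₀ ν`.

The `L²_uloc` form of Thm. 14.7 then asserts `0 = u₂` a.e. on `(0,S) × ℝ³`, so `u₂ t = 0` a.e.
for a.e. `t ∈ (0,S)`; but `‖u₂ t - θ‖₃ → 0` as `t → 0⁺` (`u₂ ∈ C([0,T); L³)`, `u₂ 0 = θ`), and
along those `t` the norm is the constant `‖θ‖₃`, whence `‖θ‖₃ = 0`, `θ = 0` (continuity), absurd.

## Mathlib / tree search

Tree: `local_leray_difference_energy_estimate`, `exists_ae_ulocEnergy_sub_le`,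
`ulocGradEnergyOn_sub_ne_top`, `le_of_max_le_two_const`, `ae_eq_zero_of_integral_inequality`,
`ae_eq_zero_of_ulocEnergy_eq_zero`, `ae_eq_strip_of_ae_slice`, `volume_restrict_strip_eq_prod`
(`LocalLerayWeakStrongProofs`); `exists_of_ae_Ioo_of_eventually_nhdsGT`
(`NSSereginMildStabilityTools`); `kato_local_holds`, `kato_isLocalLeraySolutionOn_holds`,
`isLocalLeraySolutionOn_zero`, `IsKatoSolutionOn`; `DistributionalToWeakCounterexample.θ` with
`θ_contDiff`, `θ_hasCompactSupport`, `θ_isDivFree`, `θ_continuous`, `exists_θ_ne_zero`;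
`VectorCalculus.IsDivFree.isWeaklyDivFree_holds`; `exists_saturated_euclideanSpace`,
`lintegral_le_lintegral_of_innerNull`, `lintegral_eq_zero_of_innerNull`, `innerNull_restrict`
(`SaturatedNonmeasurableSet`). Mathlib: `integral_non_aestronglyMeasurable`,
`Measure.ae_ae_of_ae_prod`, `tendsto_nhds_unique_of_frequently_eq`, `nhdsWithin_Ioo_eq_nhdsGT`,
`eLpNorm_eq_zero_iff`, `Continuous.ae_eq_iff_eq`, `Continuous.memLp_of_hasCompactSupport`.

## References

* P. G. Lemarié-Rieusset, *The Navier–Stokes Problem in the 21st Century*, CRC Press 2016,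
  doi:10.1201/b19556: §14.1 p. 488 (`L²_uloc`), Thm. 14.7 (pp. 514–518), Thm. 15.1 (A) (p. 565).
  [LemarieRieusset2016]
* P. R. Halmos, *Measure Theory* (1950), §16 Thm. E. [Halmos1950]
* T. Kato, Math. Z. 187 (1984), Thm. 1. [Kato1984]
-/

noncomputable section

open MeasureTheory TopologicalSpace Set Function Filter Topology Metric
open scoped ENNReal NNReal RealInnerProductSpace

namespace Literature.Analysis.FluidPDE

/-! ## Bochner integrals of functions supported in a set of inner measure zero -/

section InnerNull

variable {α : Type*} [MeasurableSpace α] {μ : Measure α}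
  {F : Type*} [NormedAddCommGroup F] [NormedSpace ℝ F]

omit [NormedSpace ℝ F] in
/-- **A function vanishing off a set of inner measure zero is a.e. zero as soon as it is
a.e.-strongly measurable** (its measurable modification is non-zero only on a measurable subset
of `Z` plus a null set). [folklore] -/
theorem ae_eq_zero_of_eq_zero_off_innerNull {Z : Set α}
    (hZ : ∀ S : Set α, MeasurableSet S → S ⊆ Z → μ S = 0) {f : α → F}
    (hf : ∀ x, x ∉ Z → f x = 0) (hfm : AEStronglyMeasurable f μ) : f =ᵐ[μ] 0 := by
  set g := hfm.mk f with hg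
  have hgm : StronglyMeasurable g := hfm.stronglyMeasurable_mk
  have hfg : f =ᵐ[μ] g := hfm.ae_eq_mk
  set N : Set α := toMeasurable μ {x | f x ≠ g x} with hN
  have hNm : MeasurableSet N := measurableSet_toMeasurable _ _
  have hN0 : μ N = 0 := by
    rw [hN, measure_toMeasurable]
    exact hfg
  have hSm : MeasurableSet {x | g x ≠ 0} := (hgm.measurableSet_eq_fun stronglyMeasurable_const).compl
  have hsub : {x | g x ≠ 0} \ N ⊆ Z := by
    intro x hx
    by_contra hxZ
    have h1 : f x = 0 := hf x hxZ
    have h2 : f x = g x := by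
      by_contra hne
      exact hx.2 (subset_toMeasurable μ _ hne)
    exact hx.1 (h2 ▸ h1)
  have hnull : μ {x | g x ≠ 0} = 0 := by
    have h1 : μ ({x | g x ≠ 0} \ N) = 0 := hZ _ (hSm.diff hNm) hsub
    have h2 : {x | g x ≠ 0} ⊆ ({x | g x ≠ 0} \ N) ∪ N := fun x hx => by
      by_cases hxN : x ∈ N
      · exact Or.inr hxN
      · exact Or.inl ⟨hx, hxN⟩
    exact measure_mono_null h2 (by rw [measure_union_null h1 hN0])
  have hg0 : g =ᵐ[μ] 0 := by
    have h1 : ∀ᵐ x ∂μ, ¬ (g x ≠ 0) := by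
      rw [ae_iff]
      simpa only [not_not] using hnull
    filter_upwards [h1] with x hx
    simpa using hx
  exact hfg.trans hg0

/-- **The Bochner integral of a function vanishing off a set of inner measure zero is zero**
(whether or not it is measurable: a.e. zero if a.e.-strongly measurable, junk value `0`
otherwise). [folklore] -/
theorem integral_eq_zero_of_eq_zero_off_innerNull {Z : Set α}
    (hZ : ∀ S : Set α, MeasurableSet S → S ⊆ Z → μ S = 0) {f : α → F}
    (hf : ∀ x, x ∉ Z → f x = 0) : ∫ x, f x ∂μ = 0 := by
  by_cases hfm : AEStronglyMeasurable f μ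
  · rw [integral_congr_ae (ae_eq_zero_of_eq_zero_off_innerNull hZ hf hfm)]
    simp
  · exact integral_non_aestronglyMeasurable hfm

end InnerNull

/-! ## The `L²_uloc`-datum form of weak–strong uniqueness follows from U₁ (the tree's endgame) -/

/-- **The Grönwall endgame of Thm. 14.7 from U₁, with the conclusion in the `L²_uloc`-datum form**
(verbatim the body of `local_leray_weak_strong_uniqueness_of`, `LocalLerayWeakStrongProofs.lean`,
stopped before the weakening `local_leray_weak_strong_uniqueness_of_uloc` to the `E²` datum
class): **U₁** implies weak–strong uniqueness for all data admitted by **U₁** — arbitrary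
`u₀ : ℝ³ → ℝ³` with bounded unit-ball lower integrals and `IsWeaklyDivFree u₀`. Recorded to make
the refutation of **U₁** below a one-liner. [cite: LemarieRieusset2016, Thm. 14.7, end of proof (file p. 518)] -/
theorem uloc_uniqueness_of_difference_energy_estimate
    (hE : local_leray_difference_energy_estimate) :
    ∃ ε₀ : ℝ, 0 < ε₀ ∧
      ∀ (ν T : ℝ), 0 < ν → 0 < T →
      ∀ (u₀ : (EuclideanSpace ℝ (Fin 3)) → (EuclideanSpace ℝ (Fin 3))), (∃ C : ℝ≥0, ∀ x₀ : (EuclideanSpace ℝ (Fin 3)), ∫⁻ x in ball x₀ 1, ‖u₀ x‖ₑ ^ 2 ≤ C) →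
        IsWeaklyDivFree u₀ →
      ∀ (u₁ u₂ : ℝ → (EuclideanSpace ℝ (Fin 3)) → (EuclideanSpace ℝ (Fin 3))) (p₁ p₂ : ℝ → (EuclideanSpace ℝ (Fin 3)) → ℝ),
        IsLocalLeraySolutionOn T ν u₀ u₁ p₁ → IsLocalLeraySolutionOn T ν u₀ u₂ p₂ →
      ∀ (u₃ u₄ : ℝ → (EuclideanSpace ℝ (Fin 3)) → (EuclideanSpace ℝ (Fin 3))),
        (uncurry u₁ =ᵐ[volume.restrict (Ioo 0 T ×ˢ (univ : Set (EuclideanSpace ℝ (Fin 3))))]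
          fun z => u₃ z.1 z.2 + u₄ z.1 z.2) →
        AEStronglyMeasurable (uncurry u₃) (volume.restrict (Ioo 0 T ×ˢ (univ : Set (EuclideanSpace ℝ (Fin 3))))) →
        (∃ m : ℝ → ℝ, IntegrableOn (fun t => m t ^ 2) (Ioo 0 T) volume ∧
          ∀ᵐ t ∂(volume.restrict (Ioo 0 T)), eLpNorm (u₃ t) ∞ volume ≤ ENNReal.ofReal (m t)) →
        (∃ ε : ℝ, ε < ε₀ * ν ∧
          ∀ᵐ t ∂(volume.restrict (Ioo 0 T)), eLpNorm (u₄ t) 3 volume ≤ ENNReal.ofReal ε) →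
        uncurry u₁ =ᵐ[volume.restrict (Ioo 0 T ×ˢ (univ : Set (EuclideanSpace ℝ (Fin 3))))] uncurry u₂ := by
  obtain ⟨C₁, hC₁, hE⟩ := hE
  refine ⟨(8 * C₁)⁻¹, by positivity, ?_⟩
  intro ν T hν hT u₀ hu₀ hdiv u₁ u₂ p₁ p₂ h₁ h₂ u₃ u₄ hsplit hmeas₃ hm hε
  obtain ⟨m, hm, hm₃⟩ := hm
  obtain ⟨ε, hε, hε₄⟩ := hε
  -- the data fed to the estimate: `ε' = max ε 0`, `m' = |m|`
  set ε' : ℝ := max ε 0 with hε'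
  have hε'0 : 0 ≤ ε' := le_max_right _ _
  have hε'le : ε' ≤ ν / (8 * C₁) := by
    refine max_le ?_ (by positivity)
    have : (8 * C₁)⁻¹ * ν = ν / (8 * C₁) := by rw [inv_mul_eq_div]
    linarith
  have hε₄' : ∀ᵐ t ∂(volume.restrict (Ioo 0 T)), eLpNorm (u₄ t) 3 volume ≤ ENNReal.ofReal ε' :=
    hε₄.mono fun t ht => ht.trans (ENNReal.ofReal_le_ofReal (le_max_left _ _))
  have hm' : IntegrableOn (fun t => |m t| ^ 2) (Ioo 0 T) volume := by
    simpa only [sq_abs] using hm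
  have hm₃' : ∀ᵐ t ∂(volume.restrict (Ioo 0 T)),
      eLpNorm (u₃ t) ∞ volume ≤ ENNReal.ofReal (|m t|) :=
    hm₃.mono fun t ht => ht.trans (ENNReal.ofReal_le_ofReal (le_abs_self _))
  -- the gradients of the two solutions
  obtain ⟨G₁, hG₁, hG₁b⟩ := h₁.uniformLocalGradient
  obtain ⟨G₂, hG₂, hG₂b⟩ := h₂.uniformLocalGradient
  have hΓ : ulocGradEnergyOn T (G₁ - G₂) ≠ ∞ :=
    ulocGradEnergyOn_sub_ne_top hG₁ (hG₁b 1 one_pos) (hG₂b 1 one_pos)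
  -- the local energy estimate (U₁): its second constant `C₂`, then the choice of `η`
  obtain ⟨C₂, hC₂, key⟩ := hE ν T hν hT u₀ hu₀ hdiv u₁ u₂ p₁ p₂ h₁ h₂ u₃ u₄ hsplit hmeas₃
    (fun t => |m t|) hm' hm₃' ε' hε'0 hε₄' G₁ G₂ hG₁ hG₂ hG₁b hG₂b
  set c₂ : ℝ := max C₂.toReal 1 with hc₂
  have hc₂pos : 0 < c₂ := lt_of_lt_of_le one_pos (le_max_right _ _)
  set η : ℝ := ν / (8 * c₂) with hη
  have hη0 : 0 < η := by positivity
  have keyη := key η hη0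
  -- the bound `α² ≤ M` a.e.
  obtain ⟨M, hMtop, hM⟩ := exists_ae_ulocEnergy_sub_le h₁ h₂
  -- absorption of the dissipation: `2 (C₂ η + C₁ ε') ≤ ν`
  have hcoef : 2 * (C₂ * ENNReal.ofReal η + ENNReal.ofReal C₁ * ENNReal.ofReal ε') ≤
      ENNReal.ofReal ν := by
    have hc₂ne : c₂ ≠ 0 := hc₂pos.ne'
    have h1 : C₂.toReal * η ≤ ν / 8 :=
      calc C₂.toReal * η ≤ c₂ * η := mul_le_mul_of_nonneg_right (le_max_left _ _) hη0.le
        _ = ν / 8 := by simp only [hη]; field_simp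
    have h2 : C₁ * ε' ≤ ν / 8 :=
      calc C₁ * ε' ≤ C₁ * (ν / (8 * C₁)) := mul_le_mul_of_nonneg_left hε'le hC₁.le
        _ = ν / 8 := by field_simp
    have hreal : 2 * (C₂.toReal * η + C₁ * ε') ≤ ν := by linarith
    calc 2 * (C₂ * ENNReal.ofReal η + ENNReal.ofReal C₁ * ENNReal.ofReal ε')
        = 2 * (ENNReal.ofReal C₂.toReal * ENNReal.ofReal η +
            ENNReal.ofReal C₁ * ENNReal.ofReal ε') := by rw [ENNReal.ofReal_toReal hC₂]
      _ = ENNReal.ofReal (2 * (C₂.toReal * η + C₁ * ε')) := by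
          rw [ENNReal.ofReal_mul zero_le_two, ENNReal.ofReal_ofNat,
            ENNReal.ofReal_add (mul_nonneg ENNReal.toReal_nonneg hη0.le)
              (mul_nonneg hC₁.le hε'0),
            ENNReal.ofReal_mul ENNReal.toReal_nonneg, ENNReal.ofReal_mul hC₁.le]
      _ ≤ ENNReal.ofReal ν := ENNReal.ofReal_le_ofReal hreal
  have hmain : ∀ᵐ t ∂(volume.restrict (Ioo 0 T)),
      ulocEnergy (u₁ t - u₂ t) ≤ 2 * (C₂ *
        (ENNReal.ofReal ν * (∫⁻ s in Ioo 0 t, ulocEnergy (u₁ s - u₂ s)) +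
          (∫⁻ s in Ioo 0 t, ulocEnergy (u₁ s - u₂ s)) ^ (3 / 2 : ℝ) +
          ENNReal.ofReal (η⁻¹ ^ 3) * (∫⁻ s in Ioo 0 t, ulocEnergy (u₁ s - u₂ s) ^ 3) +
          (∫⁻ s in Ioo 0 t, ENNReal.ofReal (|m s|) * ulocEnergy (u₁ s - u₂ s)) +
          ENNReal.ofReal η⁻¹ *
            (∫⁻ s in Ioo 0 t, ENNReal.ofReal (|m s| ^ 2) * ulocEnergy (u₁ s - u₂ s))) +
        ENNReal.ofReal C₁ * ENNReal.ofReal ε' * (∫⁻ s in Ioo 0 t, ulocEnergy (u₁ s - u₂ s))) := by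
    filter_upwards [keyη, ae_restrict_mem measurableSet_Ioo] with t ht htT
    have hΓt : ulocGradEnergyOn t (G₁ - G₂) ≠ ∞ :=
      ne_top_of_le_ne_top hΓ (ulocGradEnergyOn_mono htT.2.le _)
    exact le_of_max_le_two_const hΓt ENNReal.ofReal_ne_top hcoef ht
  -- Grönwall: `α = 0` a.e.
  have hm_fin : ∫⁻ t in Ioo 0 T, ENNReal.ofReal (|m t| ^ 2) ≠ ∞ := by
    have hfi := hm'.hasFiniteIntegral
    rw [HasFiniteIntegral] at hfi
    refine ne_top_of_le_ne_top hfi.ne (le_of_eq (lintegral_congr fun t => ?_))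
    exact (Real.enorm_eq_ofReal (sq_nonneg _)).symm
  have hzero : ∀ᵐ t ∂(volume.restrict (Ioo 0 T)), ulocEnergy (u₁ t - u₂ t) = 0 :=
    ae_eq_zero_of_integral_inequality (a := fun t => ulocEnergy (u₁ t - u₂ t))
      (m := fun t => |m t|) hMtop hC₂
      (ENNReal.mul_ne_top ENNReal.ofReal_ne_top ENNReal.ofReal_ne_top) ENNReal.ofReal_ne_top
      ENNReal.ofReal_ne_top ENNReal.ofReal_ne_top hM hm_fin hmain
  -- the slices coincide a.e., hence the fields coincide a.e. on the strip
  have hslice : ∀ᵐ t ∂(volume.restrict (Ioo 0 T)), u₁ t =ᵐ[volume] u₂ t := by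
    filter_upwards [hzero, h₁.ae_aestronglyMeasurable_slice, h₂.ae_aestronglyMeasurable_slice]
      with t ht hm1 hm2
    have h0 := ae_eq_zero_of_ulocEnergy_eq_zero (hm1.sub hm2) ht
    filter_upwards [h0] with x hx
    exact sub_eq_zero.1 (by simpa only [Pi.sub_apply, Pi.zero_apply] using hx)
  exact ae_eq_strip_of_ae_slice h₁.aestronglyMeasurable h₂.aestronglyMeasurable hslice



/-! ## The counterexample -/

namespace LocalLerayNonmeasurableDatum

open DistributionalToWeakCounterexample

/-- `θ ∈ L³` (continuous with compact support). [folklore] -/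
theorem memLp_θ : MemLp θ 3 (volume : Measure (EuclideanSpace ℝ (Fin 3))) :=
  θ_continuous.memLp_of_hasCompactSupport θ_hasCompactSupport

/-- `θ` is weakly divergence free (`C¹` and divergence free). [folklore] -/
theorem isWeaklyDivFree_θ : IsWeaklyDivFree θ :=
  VectorCalculus.IsDivFree.isWeaklyDivFree_holds θ_isDivFree
    (θ_contDiff.of_le (by exact_mod_cast le_top))

/-- `θ` is not a.e. zero (it is continuous and not identically zero). [folklore] -/
theorem not_θ_ae_eq_zero : ¬ (θ =ᵐ[(volume : Measure (EuclideanSpace ℝ (Fin 3)))] 0) := by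
  intro h
  have h0 : θ = 0 := (Continuous.ae_eq_iff_eq volume θ_continuous continuous_const).1 h
  obtain ⟨x, hx⟩ := exists_θ_ne_zero
  exact hx (by rw [h0]; rfl)

/-- **The `L²_uloc`-datum form of weak–strong uniqueness is false.** See the module docstring
for the counterexample: the datum `𝟙_A θ` over a saturated non-measurable set `A` is attained,
in the sense of the lower integrals of `IsLocalLeraySolutionOn.initial`, both by the zero flow
and by the Kato solution with datum `θ ≢ 0`. [cite: Halmos1950, §16 Theorem E (the saturated set); counterexample to the uloc form of LemarieRieusset2016 Thm. 14.7 as transcribed] -/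
theorem not_uloc_uniqueness :
    ¬ (∃ ε₀ : ℝ, 0 < ε₀ ∧
      ∀ (ν T : ℝ), 0 < ν → 0 < T →
      ∀ (u₀ : (EuclideanSpace ℝ (Fin 3)) → (EuclideanSpace ℝ (Fin 3))), (∃ C : ℝ≥0, ∀ x₀ : (EuclideanSpace ℝ (Fin 3)), ∫⁻ x in ball x₀ 1, ‖u₀ x‖ₑ ^ 2 ≤ C) →
        IsWeaklyDivFree u₀ →
      ∀ (u₁ u₂ : ℝ → (EuclideanSpace ℝ (Fin 3)) → (EuclideanSpace ℝ (Fin 3))) (p₁ p₂ : ℝ → (EuclideanSpace ℝ (Fin 3)) → ℝ),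
        IsLocalLeraySolutionOn T ν u₀ u₁ p₁ → IsLocalLeraySolutionOn T ν u₀ u₂ p₂ →
      ∀ (u₃ u₄ : ℝ → (EuclideanSpace ℝ (Fin 3)) → (EuclideanSpace ℝ (Fin 3))),
        (uncurry u₁ =ᵐ[volume.restrict (Ioo 0 T ×ˢ (univ : Set (EuclideanSpace ℝ (Fin 3))))]
          fun z => u₃ z.1 z.2 + u₄ z.1 z.2) →
        AEStronglyMeasurable (uncurry u₃) (volume.restrict (Ioo 0 T ×ˢ (univ : Set (EuclideanSpace ℝ (Fin 3))))) →
        (∃ m : ℝ → ℝ, IntegrableOn (fun t => m t ^ 2) (Ioo 0 T) volume ∧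
          ∀ᵐ t ∂(volume.restrict (Ioo 0 T)), eLpNorm (u₃ t) ∞ volume ≤ ENNReal.ofReal (m t)) →
        (∃ ε : ℝ, ε < ε₀ * ν ∧
          ∀ᵐ t ∂(volume.restrict (Ioo 0 T)), eLpNorm (u₄ t) 3 volume ≤ ENNReal.ofReal ε) →
        uncurry u₁ =ᵐ[volume.restrict (Ioo 0 T ×ˢ (univ : Set (EuclideanSpace ℝ (Fin 3))))] uncurry u₂) := by
  rintro ⟨ε₀, hε₀, H⟩
  -- the saturated set and the datum
  obtain ⟨A, hA, hAc⟩ := Literature.MeasureTheory.Lebesgue.exists_saturated_euclideanSpace 2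
  set u₀ : (EuclideanSpace ℝ (Fin 3)) → (EuclideanSpace ℝ (Fin 3)) := A.indicator θ with hu₀
  have hu₀A : ∀ x ∈ A, u₀ x = θ x := fun x hx => indicator_of_mem hx θ
  have hu₀Ac : ∀ x, x ∉ A → u₀ x = 0 := fun x hx => indicator_of_notMem hx θ
  -- the Kato solution with datum `θ` and its local Leray structure on `(0, S)`
  obtain ⟨T, hT, u, hmild, hcont, hinit, hmeas⟩ := kato_local_holds 1 one_pos θ memLp_θ
    isWeaklyDivFree_θ
  have hK : IsKatoSolutionOn T 1 θ u := ⟨hmild, hcont, hinit, hmeas⟩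
  set S : ℝ := T / 2 with hS
  have hS0 : 0 < S := by positivity
  have hST : S < T := by simp only [hS]; linarith
  obtain ⟨p, hp⟩ := kato_isLocalLeraySolutionOn_holds 1 T θ u one_pos hK S hS0 hST
  -- `u` is a local Leray solution with datum `u₀` as well
  have h₂ : IsLocalLeraySolutionOn S 1 u₀ u p :=
    { hp with
      initial := fun K hKc => by
        have hslice : ∀ t ∈ Ioo (0 : ℝ) T, ∫⁻ x in K, ‖u t x - u₀ x‖ₑ ^ 2 ≤
            ∫⁻ x in K, ‖u t x - θ x‖ₑ ^ 2 := by
          intro t ht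
          have hmt : AEStronglyMeasurable (u t) volume := (hK.memLp ⟨ht.1.le, ht.2⟩).1
          refine Literature.MeasureTheory.Lebesgue.lintegral_le_lintegral_of_innerNull
            (Literature.MeasureTheory.Lebesgue.innerNull_restrict hAc K)
            ((hmt.sub θ_continuous.aestronglyMeasurable).enorm.pow_const 2).restrict
            fun x hx => ?_
          rw [hu₀A x (not_notMem.1 hx)]
        refine tendsto_of_tendsto_of_tendsto_of_le_of_le' tendsto_const_nhds (hp.initial K hKc)
          (Eventually.of_forall fun t => bot_le) ?_
        filter_upwards [Ioo_mem_nhdsGT hT] with t ht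
        exact hslice t ht }
  -- the zero flow is a local Leray solution with datum `u₀`
  have h₁ : IsLocalLeraySolutionOn S 1 u₀ (0 : ℝ → (EuclideanSpace ℝ (Fin 3)) → (EuclideanSpace ℝ (Fin 3))) (0 : ℝ → (EuclideanSpace ℝ (Fin 3)) → ℝ) :=
    { isLocalLeraySolutionOn_zero S 1 with
      initial := fun K hKc => by
        have hzero : ∀ t : ℝ, ∫⁻ x in K, ‖(0 : ℝ → (EuclideanSpace ℝ (Fin 3)) → (EuclideanSpace ℝ (Fin 3))) t x - u₀ x‖ₑ ^ 2 = 0 := by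
          intro t
          refine Literature.MeasureTheory.Lebesgue.lintegral_eq_zero_of_innerNull
            (Literature.MeasureTheory.Lebesgue.innerNull_restrict hA K) fun x hx => ?_
          simp [hu₀Ac x hx]
        simp only [hzero]
        exact tendsto_const_nhds }
  -- the hypotheses on the datum
  have huloc : ∃ C : ℝ≥0, ∀ x₀ : (EuclideanSpace ℝ (Fin 3)), ∫⁻ x in ball x₀ 1, ‖u₀ x‖ₑ ^ 2 ≤ C := by
    refine ⟨0, fun x₀ => le_of_eq ?_⟩
    rw [ENNReal.coe_zero]
    refine Literature.MeasureTheory.Lebesgue.lintegral_eq_zero_of_innerNull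
      (Literature.MeasureTheory.Lebesgue.innerNull_restrict hA _) fun x hx => ?_
    simp [hu₀Ac x hx]
  have hdiv : IsWeaklyDivFree u₀ := by
    intro ϑ _
    refine integral_eq_zero_of_eq_zero_off_innerNull hA fun x hx => ?_
    simp [hu₀Ac x hx]
  -- the splitting `0 = 0 + 0`, `m = 0`, `ε = 0`
  have hsplit : uncurry (0 : ℝ → (EuclideanSpace ℝ (Fin 3)) → (EuclideanSpace ℝ (Fin 3))) =ᵐ[volume.restrict (Ioo 0 S ×ˢ (univ : Set (EuclideanSpace ℝ (Fin 3))))]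
      fun z => (0 : ℝ → (EuclideanSpace ℝ (Fin 3)) → (EuclideanSpace ℝ (Fin 3))) z.1 z.2 + (0 : ℝ → (EuclideanSpace ℝ (Fin 3)) → (EuclideanSpace ℝ (Fin 3))) z.1 z.2 :=
    Eventually.of_forall fun z => by simp [Function.uncurry_def]
  have hmeas₃ : AEStronglyMeasurable (uncurry (0 : ℝ → (EuclideanSpace ℝ (Fin 3)) → (EuclideanSpace ℝ (Fin 3))))
      (volume.restrict (Ioo 0 S ×ˢ (univ : Set (EuclideanSpace ℝ (Fin 3))))) := aestronglyMeasurable_const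
  have hm : ∃ m : ℝ → ℝ, IntegrableOn (fun t => m t ^ 2) (Ioo 0 S) volume ∧
      ∀ᵐ t ∂(volume.restrict (Ioo 0 S)),
        eLpNorm ((0 : ℝ → (EuclideanSpace ℝ (Fin 3)) → (EuclideanSpace ℝ (Fin 3))) t) ∞ volume ≤ ENNReal.ofReal (m t) :=
    ⟨fun _ => 0, by simp, Eventually.of_forall fun t => by simp⟩
  have hε : ∃ ε : ℝ, ε < ε₀ * 1 ∧
      ∀ᵐ t ∂(volume.restrict (Ioo 0 S)),
        eLpNorm ((0 : ℝ → (EuclideanSpace ℝ (Fin 3)) → (EuclideanSpace ℝ (Fin 3))) t) 3 volume ≤ ENNReal.ofReal ε :=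
    ⟨0, by linarith, Eventually.of_forall fun t => by simp⟩
  -- the uniqueness statement: `0 = u` a.e. on the strip
  have key := H 1 S one_pos hS0 u₀ huloc hdiv 0 u 0 p h₁ h₂ 0 0 hsplit hmeas₃ hm hε
  -- hence `u t = 0` a.e. for a.e. `t ∈ (0,S)`
  have hslice : ∀ᵐ t ∂(volume.restrict (Ioo 0 S)), u t =ᵐ[volume] 0 := by
    have h1 : ∀ᵐ z ∂(volume.restrict (Ioo 0 S ×ˢ (univ : Set (EuclideanSpace ℝ (Fin 3))))), u z.1 z.2 = 0 := by
      filter_upwards [key] with z hz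
      simpa [Function.uncurry_def] using hz.symm
    rw [volume_restrict_strip_eq_prod] at h1
    filter_upwards [Measure.ae_ae_of_ae_prod h1] with t ht
    filter_upwards [ht] with x hx
    simpa using hx
  -- along those `t`, `‖u t - θ‖₃ = ‖θ‖₃`
  have hnorm : ∀ᵐ t ∂(volume.restrict (Ioo 0 S)),
      eLpNorm (u t - u 0) 3 volume = eLpNorm θ 3 volume := by
    filter_upwards [hslice] with t ht
    rw [hinit]
    have h1 : u t - θ =ᵐ[volume] -θ := by
      filter_upwards [ht] with x hx
      simp [hx]
    rw [eLpNorm_congr_ae h1, eLpNorm_neg]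
  -- `‖u t - θ‖₃ → 0` as `t → 0⁺`
  have htend : Tendsto (fun t => eLpNorm (u t - u 0) 3 volume) (𝓝[>] (0 : ℝ)) (𝓝 0) := by
    have h1 := hK.continuousInLpOn.2 0 ⟨le_rfl, hT⟩
    refine h1.mono_left ?_
    rw [← nhdsWithin_Ioo_eq_nhdsGT hT]
    exact nhdsWithin_mono _ Ioo_subset_Ico_self
  have hfreq : ∃ᶠ t in 𝓝[>] (0 : ℝ), eLpNorm (u t - u 0) 3 volume = eLpNorm θ 3 volume := by
    by_contra hne
    rw [Filter.not_frequently] at hne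
    obtain ⟨t, -, ht, ht'⟩ := exists_of_ae_Ioo_of_eventually_nhdsGT hS0 hnorm hne
    exact ht' ht
  have hθ0 : eLpNorm θ 3 (volume : Measure (EuclideanSpace ℝ (Fin 3))) = 0 :=
    (tendsto_nhds_unique_of_frequently_eq htend tendsto_const_nhds hfreq).symm
  have hae : θ =ᵐ[(volume : Measure (EuclideanSpace ℝ (Fin 3)))] 0 :=
    (eLpNorm_eq_zero_iff θ_continuous.aestronglyMeasurable (by norm_num)).1 hθ0
  exact not_θ_ae_eq_zero hae

end LocalLerayNonmeasurableDatum

/-! ## The refutations -/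

/-- **The `L²_uloc`-datum form of Lemarié-Rieusset 2016, Thm. 14.7, as transcribed without
measurability of the datum — the hypothesis of `local_leray_weak_strong_uniqueness_of_uloc` — is
FALSE.** [cite: Halmos1950, §16 Theorem E (the saturated set behind the counterexample)] -/
theorem not_local_leray_weak_strong_uniqueness_uloc :
    ¬ (∃ ε₀ : ℝ, 0 < ε₀ ∧
      ∀ (ν T : ℝ), 0 < ν → 0 < T →
      ∀ (u₀ : (EuclideanSpace ℝ (Fin 3)) → (EuclideanSpace ℝ (Fin 3))), (∃ C : ℝ≥0, ∀ x₀ : (EuclideanSpace ℝ (Fin 3)), ∫⁻ x in ball x₀ 1, ‖u₀ x‖ₑ ^ 2 ≤ C) →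
        IsWeaklyDivFree u₀ →
      ∀ (u₁ u₂ : ℝ → (EuclideanSpace ℝ (Fin 3)) → (EuclideanSpace ℝ (Fin 3))) (p₁ p₂ : ℝ → (EuclideanSpace ℝ (Fin 3)) → ℝ),
        IsLocalLeraySolutionOn T ν u₀ u₁ p₁ → IsLocalLeraySolutionOn T ν u₀ u₂ p₂ →
      ∀ (u₃ u₄ : ℝ → (EuclideanSpace ℝ (Fin 3)) → (EuclideanSpace ℝ (Fin 3))),
        (uncurry u₁ =ᵐ[volume.restrict (Ioo 0 T ×ˢ (univ : Set (EuclideanSpace ℝ (Fin 3))))]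
          fun z => u₃ z.1 z.2 + u₄ z.1 z.2) →
        AEStronglyMeasurable (uncurry u₃) (volume.restrict (Ioo 0 T ×ˢ (univ : Set (EuclideanSpace ℝ (Fin 3))))) →
        (∃ m : ℝ → ℝ, IntegrableOn (fun t => m t ^ 2) (Ioo 0 T) volume ∧
          ∀ᵐ t ∂(volume.restrict (Ioo 0 T)), eLpNorm (u₃ t) ∞ volume ≤ ENNReal.ofReal (m t)) →
        (∃ ε : ℝ, ε < ε₀ * ν ∧
          ∀ᵐ t ∂(volume.restrict (Ioo 0 T)), eLpNorm (u₄ t) 3 volume ≤ ENNReal.ofReal ε) →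
        uncurry u₁ =ᵐ[volume.restrict (Ioo 0 T ×ˢ (univ : Set (EuclideanSpace ℝ (Fin 3))))] uncurry u₂) :=
  LocalLerayNonmeasurableDatum.not_uloc_uniqueness

/-- **REFUTATION of the named fact U₁** `local_leray_difference_energy_estimate` (the local energy
estimate for the difference of two local Leray solutions, transcribed from Lemarié-Rieusset 2016,
proof of Thm. 14.7, WITHOUT measurability of the datum `u₀`): it implies the false `L²_uloc`-datum
uniqueness statement (`uloc_uniqueness_of_difference_energy_estimate`). The mis-statement is the
missing hypothesis `AEStronglyMeasurable u₀ volume` (`u₀ ∈ L²_uloc` in the book); the corrected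
fact lives in `LocalLerayWeakStrongMeasurable.lean`. [cite: LemarieRieusset2016, Thm. 14.7, proof (file pp. 515–518) — transcription error: datum measurability] -/
theorem not_local_leray_difference_energy_estimate : ¬ local_leray_difference_energy_estimate :=
  fun h => not_local_leray_weak_strong_uniqueness_uloc
    (uloc_uniqueness_of_difference_energy_estimate h)

/-- **The per-ball inequality of the inline programme cannot hold for all data of U₁ either**
(the hypothesis of `local_leray_difference_energy_estimate_of_forall_ball`,
`LocalLerayDifferenceAssembly.lean`, which implies **U₁**): steps 1–4 of the proof plan must be
carried out for *measurable* data, delivering the hypothesis of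
`measurable_datum_estimate_of_forall_ball` (`LocalLerayWeakStrongMeasurable.lean`) instead.
[cite: LemarieRieusset2016, Thm. 14.7, proof (file pp. 515–518) — transcription error: datum measurability] -/
theorem not_forall_ball_estimate :
    ¬ (∃ C : ℝ≥0,
      ∀ (ν T : ℝ), 0 < ν → 0 < T →
      ∀ (u₀ : (EuclideanSpace ℝ (Fin 3)) → (EuclideanSpace ℝ (Fin 3))), (∃ C : ℝ≥0, ∀ x₀ : (EuclideanSpace ℝ (Fin 3)), ∫⁻ x in ball x₀ 1, ‖u₀ x‖ₑ ^ 2 ≤ C) →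
        IsWeaklyDivFree u₀ →
      ∀ (u₁ u₂ : ℝ → (EuclideanSpace ℝ (Fin 3)) → (EuclideanSpace ℝ (Fin 3))) (p₁ p₂ : ℝ → (EuclideanSpace ℝ (Fin 3)) → ℝ),
        IsLocalLeraySolutionOn T ν u₀ u₁ p₁ → IsLocalLeraySolutionOn T ν u₀ u₂ p₂ →
      ∀ (u₃ u₄ : ℝ → (EuclideanSpace ℝ (Fin 3)) → (EuclideanSpace ℝ (Fin 3))),
        (uncurry u₁ =ᵐ[volume.restrict (Ioo 0 T ×ˢ (univ : Set (EuclideanSpace ℝ (Fin 3))))]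
          fun z => u₃ z.1 z.2 + u₄ z.1 z.2) →
        AEStronglyMeasurable (uncurry u₃) (volume.restrict (Ioo 0 T ×ˢ (univ : Set (EuclideanSpace ℝ (Fin 3))))) →
      ∀ (m : ℝ → ℝ), IntegrableOn (fun t => m t ^ 2) (Ioo 0 T) volume →
        (∀ᵐ t ∂(volume.restrict (Ioo 0 T)), eLpNorm (u₃ t) ∞ volume ≤ ENNReal.ofReal (m t)) →
      ∀ (ε : ℝ), 0 ≤ ε →
        (∀ᵐ t ∂(volume.restrict (Ioo 0 T)), eLpNorm (u₄ t) 3 volume ≤ ENNReal.ofReal ε) →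
      ∀ (G₁ G₂ : ℝ → (EuclideanSpace ℝ (Fin 3)) → (EuclideanSpace ℝ (Fin 3)) →L[ℝ] (EuclideanSpace ℝ (Fin 3))),
        HasWeakSpatialGradientOn (slab (EuclideanSpace ℝ (Fin 3)) (Ioo 0 T) isOpen_Ioo) u₁ G₁ →
        HasWeakSpatialGradientOn (slab (EuclideanSpace ℝ (Fin 3)) (Ioo 0 T) isOpen_Ioo) u₂ G₂ →
        (∀ R : ℝ, 0 < R → ∃ C : ℝ≥0, ∀ x₀ : (EuclideanSpace ℝ (Fin 3)),
          ∫⁻ z in Ioo 0 T ×ˢ ball x₀ R, ENNReal.ofReal (frobeniusNormSq (G₁ z.1 z.2)) ≤ C) →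
        (∀ R : ℝ, 0 < R → ∃ C : ℝ≥0, ∀ x₀ : (EuclideanSpace ℝ (Fin 3)),
          ∫⁻ z in Ioo 0 T ×ˢ ball x₀ R, ENNReal.ofReal (frobeniusNormSq (G₂ z.1 z.2)) ≤ C) →
      ∀ x₀ : (EuclideanSpace ℝ (Fin 3)), ∀ᵐ t ∂(volume.restrict (Ioo 0 T)),
        (∫⁻ x in ball x₀ 1, ‖(u₁ t - u₂ t) x‖ₑ ^ 2) +
          ENNReal.ofReal ν *
            (∫⁻ z in Ioo 0 t ×ˢ ball x₀ 1, ENNReal.ofReal (frobeniusNormSq ((G₁ - G₂) z.1 z.2))) ≤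
        C * (ENNReal.ofReal ν * (∫⁻ s in Ioo 0 t, ulocEnergy (u₁ s - u₂ s)) +
            (⨆ y : (EuclideanSpace ℝ (Fin 3)), ∫⁻ z in Ioo 0 t ×ˢ ball y 1, ‖u₁ z.1 z.2 - u₂ z.1 z.2‖ₑ ^ 3) +
            (∫⁻ s in Ioo 0 t, ENNReal.ofReal (m s) * ulocEnergy (u₁ s - u₂ s)) +
            ulocGradEnergyOn t (G₁ - G₂) ^ (1 / 2 : ℝ) *
              (∫⁻ s in Ioo 0 t, ENNReal.ofReal (m s ^ 2) * ulocEnergy (u₁ s - u₂ s)) ^ (1 / 2 : ℝ) +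
            ENNReal.ofReal ε *
              ((∫⁻ s in Ioo 0 t, ulocEnergy (u₁ s - u₂ s)) + ulocGradEnergyOn t (G₁ - G₂)))) :=
  fun h => not_local_leray_difference_energy_estimate
    (local_leray_difference_energy_estimate_of_forall_ball h)

end Literature.Analysis.FluidPDE
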